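import Summits.Ventures.PercRepro.RankLevelSetIndepCD
import Summits.Ventures.PercRepro.RankLevelSetBiIndepTruncate

/-! # RankLevelSetIndepCDTruncate — THE (CD)-CLASS IS CLOSED UNDER TRUNCATION (night-1 g27; dossier §39.10)

For the truncation `truncateTo M k` (independent = independent in `M` of size `≤ k`) the contraction/deletion
profiles at `e` are windows of those of `M`: `x_m(T_k M; e) = x_m(M; e)` for `m + 1 ≤ k` and `0` beyond
(`contractCount_truncateTo`), `y_m(T_k M; e) = y_m(M; e)` for `m ≤ k` and `0` beyond (`deleteCount_truncateTo`). Hence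
(CD) at level `m` for the truncation is (CD) for `M` when `m + 2 ≤ k`, and trivial (`x_{m+1} = 0`) otherwise:
**`indepCD_truncateTo : IndepCD M → IndepCD (truncateTo M k)`**. Every declaration has a docstring; imports: the
cell's own modules and Mathlib only. Axioms: standard. -/

namespace PercRepro

open Set Matroid

variable {α : Type} (M : Matroid α) [M.Finite]

/-- **The contraction profile of the truncation is a window**: `x_m(T_k M; e) = x_m(M; e)` if `m + 1 ≤ k`, else `0`. -/
lemma contractCount_truncateTo (e : α) (k m : ℕ) :
    haveI := truncateTo_finite M k
    contractCount (truncateTo M k) e m = if m + 1 ≤ k then contractCount M e m else 0 := by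
  haveI := truncateTo_finite M k
  have hE' : (M.E \ {e}).Finite := M.ground_finite.subset Set.sdiff_subset
  unfold contractCount
  simp only [truncateTo_E, truncateTo_indep_iff]
  split_ifs with hmk
  · congr 1
    ext T
    simp only [Set.mem_setOf_eq]
    constructor
    · rintro ⟨hTE, hT, hind, -⟩; exact ⟨hTE, hT, hind⟩
    · rintro ⟨hTE, hT, hind⟩
      refine ⟨hTE, hT, hind, ?_⟩
      have heT : e ∉ T := fun hmem => (hTE hmem).2 rfl
      rw [Set.ncard_insert_of_notMem heT (hE'.subset hTE), hT]
      exact hmk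
  · rw [Set.ncard_eq_zero (hE'.finite_subsets.subset (fun T hT => hT.1))]
    ext T
    simp only [Set.mem_setOf_eq, Set.mem_empty_iff_false, iff_false, not_and]
    intro hTE hT _ hcard
    have heT : e ∉ T := fun hmem => (hTE hmem).2 rfl
    rw [Set.ncard_insert_of_notMem heT (hE'.subset hTE), hT] at hcard
    exact hmk hcard

/-- **The deletion profile of the truncation is a window**: `y_m(T_k M; e) = y_m(M; e)` if `m ≤ k`, else `0`. -/
lemma deleteCount_truncateTo (e : α) (k m : ℕ) :
    haveI := truncateTo_finite M k
    deleteCount (truncateTo M k) e m = if m ≤ k then deleteCount M e m else 0 := by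
  haveI := truncateTo_finite M k
  have hE' : (M.E \ {e}).Finite := M.ground_finite.subset Set.sdiff_subset
  unfold deleteCount
  simp only [truncateTo_E, truncateTo_indep_iff]
  split_ifs with hmk
  · congr 1
    ext T
    simp only [Set.mem_setOf_eq]
    constructor
    · rintro ⟨hTE, hT, hind, -⟩; exact ⟨hTE, hT, hind⟩
    · rintro ⟨hTE, hT, hind⟩
      exact ⟨hTE, hT, hind, hT ▸ hmk⟩
  · rw [Set.ncard_eq_zero (hE'.finite_subsets.subset (fun T hT => hT.1))]
    ext T
    simp only [Set.mem_setOf_eq, Set.mem_empty_iff_false, iff_false, not_and]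
    intro _ hT _ hcard
    rw [hT] at hcard
    exact hmk hcard

/-- **THE (CD)-CLASS IS CLOSED UNDER TRUNCATION**: `IndepCD M → IndepCD (truncateTo M k)`. -/
theorem indepCD_truncateTo (h : IndepCD M) (k : ℕ) :
    haveI := truncateTo_finite M k
    IndepCD (truncateTo M k) := by
  haveI := truncateTo_finite M k
  intro e he m
  rw [truncateTo_E] at he
  rw [contractCount_truncateTo, contractCount_truncateTo, deleteCount_truncateTo, deleteCount_truncateTo]
  by_cases hmk : m + 2 ≤ k
  · rw [if_pos (by omega), if_pos (by omega), if_pos (by omega), if_pos (by omega)]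
    exact h e he m
  · rw [if_neg (by omega), zero_mul]
    exact Nat.zero_le _

end PercRepro
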